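import Summits.Ventures.DiscreteObjects.PP12.CentralCollineation

/-!
# PP(12), families B1-p / B1-p+: fixed structure of a collineation of order 13 (antiflag) and of order 11
# (homology or 'two fixed points per fixed line') — kernel versions of FAMILY-B1P Lemma 4 / FAMILY-B1P-PLUS Lemma 5
Framing: lottery ticket; floor = certified bounds/negative ranges.

For a projective plane of order 12 (Mathlib `Configuration.ProjectivePlane`) and a collineation `σ ≠ 1`:

* `q = 13` (`σ¹³ = 1` on points and lines): no fixed line carries a fixed point (`no_fixed_point_on_fixed_line_q13`),
  there is EXACTLY ONE fixed point and EXACTLY ONE fixed line (`existsUnique_fixed_point_q13`,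
  `existsUnique_fixed_line_q13`) — the antiflag of FAMILY-B1P-PLUS Lemma 5, from which the orbit-matrix
  normal form is derived on paper;
* `q = 11`: either `σ` is a HOMOLOGY (an axis `l` and a centre `c ∉ l`: Case A of FAMILY-B1P Lemma 4) or every
  fixed line carries exactly two fixed points (`order12_q11_axis_or_two`); the dual statement and `f = 3`
  (triangle) are the remaining paper steps of Case B.

Also: the dual collineation (`Collineation.dual`, acting on Mathlib's `Configuration.Dual`), `σ.onLines ^ k`
is determined by `σ.onPoints ^ k` (`pow_mem_iff`, `onLines_pow_eq_one`).
-/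

namespace Summit.Ventures.DiscreteObjects.PP12

open Configuration Finset

namespace Collineation

variable {P L : Type*} [Membership P L] (σ : Collineation P L)

/-- The dual collineation: the same maps, acting on the dual configuration (lines as points). -/
def dual : Collineation (Dual L) (Dual P) where
  onPoints := σ.onLines
  onLines := σ.onPoints
  mem_iff := fun m c => σ.mem_iff c m

/-- the dual collineation acts on dual points (= lines) by `σ.onLines` -/
@[simp] theorem dual_onPoints : σ.dual.onPoints = σ.onLines := rfl
/-- the dual collineation acts on dual lines (= points) by `σ.onPoints` -/
@[simp] theorem dual_onLines : σ.dual.onLines = σ.onPoints := rfl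

/-- Powers of a collineation preserve incidence. -/
theorem pow_mem_iff (k : ℕ) (p : P) (m : L) : (σ.onPoints ^ k) p ∈ (σ.onLines ^ k) m ↔ p ∈ m := by
  induction k generalizing p m with
  | zero => simp
  | succ k ih =>
    rw [pow_succ', pow_succ', Equiv.Perm.mul_apply, Equiv.Perm.mul_apply, σ.mem_iff]
    exact ih p m

variable [ProjectivePlane P L]

/-- In a projective plane a line is determined by its points, so `σ ^ k = 1` on points forces
`σ ^ k = 1` on lines. -/
theorem onLines_pow_eq_one [Finite P] [Finite L] {k : ℕ} (hk : σ.onPoints ^ k = 1) :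
    σ.onLines ^ k = 1 := by
  ext m
  -- two distinct points of m lie on (σL^k) m
  have hmem : ∀ p : P, p ∈ m → p ∈ (σ.onLines ^ k) m := fun p hp => by
    have := (σ.pow_mem_iff k p m).2 hp
    rwa [hk, Equiv.Perm.one_apply] at this
  classical
  cases nonempty_fintype P; cases nonempty_fintype L
  obtain ⟨a, b, -, ha, hb, -, hab, -, -⟩ := exists_three_points (P := P) m
  simpa using ((Nondegenerate.eq_or_eq (hmem a ha) (hmem b hb) ha hb).resolve_left hab)

variable [Fintype P] [Fintype L] [DecidableEq P] [DecidableEq L]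

omit [DecidableEq L] in
/-- If a line carries as many fixed points as it has points, it is an axis. -/
theorem isAxis_of_fixedOnLine_eq {l : L} [DecidablePred (· ∈ l)]
    (h : σ.fixedOnLine l = ProjectivePlane.order P L + 1) : σ.IsAxis l := by
  intro p hp
  -- the filter of fixed points on l has the cardinality of all points on l, hence contains p
  have hsub : (univ.filter fun x => x ∈ l ∧ σ.onPoints x = x) ⊆ univ.filter fun x => x ∈ l :=
    fun x hx => by simp only [mem_filter, mem_univ, true_and] at hx ⊢; exact hx.1
  have hcard : (univ.filter fun x : P => x ∈ l).card = ProjectivePlane.order P L + 1 := by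
    rw [← ProjectivePlane.pointCount_eq P l, pointCount, Nat.card_eq_fintype_card, Fintype.card_subtype]
  have heq := Finset.eq_of_subset_of_card_le hsub (by rw [hcard, ← h]; rfl)
  have : p ∈ univ.filter fun x : P => x ∈ l := by simp [hp]
  rw [← heq] at this
  simp only [mem_filter, mem_univ, true_and] at this
  exact this.2

omit [ProjectivePlane P L] [Fintype L] [DecidableEq L] in
/-- If a line's fixed-point count is zero, no point of it is fixed. -/
theorem not_fixed_of_fixedOnLine_eq_zero {l : L} [DecidablePred (· ∈ l)] (h : σ.fixedOnLine l = 0)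
    {p : P} (hp : p ∈ l) : σ.onPoints p ≠ p := by
  intro fp
  unfold fixedOnLine at h
  rw [Finset.card_eq_zero] at h
  have : p ∈ univ.filter fun x => x ∈ l ∧ σ.onPoints x = x := by simp [hp, fp]
  rw [h] at this
  simp at this

section OrderTwelve

variable (h12 : ProjectivePlane.order P L = 12) (hne : σ.onPoints ≠ 1)
include h12 hne

omit [DecidableEq L] in
/-- **q = 13: a fixed line carries no fixed point.** (13 fixed points would make the line an axis, impossible by
`not_isAxis_order12`; otherwise the count is 0 by `fixedOnLine_order12_q13`.) -/
theorem no_fixed_point_on_fixed_line_q13 (hq : σ.onPoints ^ 13 = 1) {l : L} (hl : σ.onLines l = l)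
    {p : P} (hp : p ∈ l) : σ.onPoints p ≠ p := by
  classical
  haveI : Fact (Nat.Prime 13) := ⟨by norm_num⟩
  rcases σ.fixedOnLine_order12_q13 h12 hl hq with h0 | h13
  · exact σ.not_fixed_of_fixedOnLine_eq_zero h0 hp
  · exfalso
    have hax : σ.IsAxis l := σ.isAxis_of_fixedOnLine_eq (by rw [h13, h12])
    exact σ.not_isAxis_order12 h12 hne hq (Or.inr (Or.inr rfl)) l hax

omit [DecidableEq L] in
/-- **q = 13: exactly one fixed point.** -/
theorem existsUnique_fixed_point_q13 (hq : σ.onPoints ^ 13 = 1) : ∃! p : P, σ.onPoints p = p := by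
  classical
  haveI : Fact (Nat.Prime 13) := ⟨by norm_num⟩
  -- existence: the number of fixed points is ≡ 1 (mod 13)
  have hcount := (σ.fixedCard_order12 h12).2.2 hq
  have hpos : fixedCard σ.onPoints ≠ 0 := by omega
  unfold fixedCard at hpos
  obtain ⟨p, hp⟩ := Finset.card_pos.mp (Nat.pos_of_ne_zero hpos)
  simp only [mem_filter, mem_univ, true_and] at hp
  refine ⟨p, hp, fun p' hp' => ?_⟩
  by_contra hne'
  -- the line through two fixed points is fixed and carries a fixed point
  have fm := σ.line_fixed_of_two_fixed (HasLines.mkLine_ax (L := L) hne').1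
    (HasLines.mkLine_ax (L := L) hne').2 hne' hp' hp
  exact σ.no_fixed_point_on_fixed_line_q13 h12 hne hq fm (HasLines.mkLine_ax (L := L) hne').1 hp'

/-- **q = 13: exactly one fixed line** (and, by `no_fixed_point_on_fixed_line_q13`, it misses the fixed point:
the fixed structure is an antiflag). -/
theorem existsUnique_fixed_line_q13 (hq : σ.onPoints ^ 13 = 1) : ∃! l : L, σ.onLines l = l := by
  classical
  haveI : Fact (Nat.Prime 13) := ⟨by norm_num⟩
  have hqL : σ.onLines ^ 13 = 1 := σ.onLines_pow_eq_one hq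
  -- existence: the number of fixed lines is ≡ 157 ≡ 1 (mod 13)
  have hcount : fixedCard σ.onLines ≡ Fintype.card L [MOD 13] := fixedCard_modEq hqL
  rw [ProjectivePlane.card_lines P L, h12] at hcount
  unfold Nat.ModEq at hcount
  have hpos : fixedCard σ.onLines ≠ 0 := by omega
  unfold fixedCard at hpos
  obtain ⟨l, hl⟩ := Finset.card_pos.mp (Nat.pos_of_ne_zero hpos)
  simp only [mem_filter, mem_univ, true_and] at hl
  refine ⟨l, hl, fun l' hl' => ?_⟩
  by_contra hne'
  -- two fixed lines meet in a fixed point lying on a fixed line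
  have hx := HasPoints.mkPoint_ax (P := P) hne'
  have fx := σ.point_fixed_of_two_fixed hx.1 hx.2 hne' hl' hl
  exact σ.no_fixed_point_on_fixed_line_q13 h12 hne hq hl hx.2 fx

omit [DecidableEq L] in
/-- **q = 13: the fixed point is off the fixed line** (antiflag). -/
theorem fixed_point_not_mem_fixed_line_q13 (hq : σ.onPoints ^ 13 = 1) {p : P} (hp : σ.onPoints p = p)
    {l : L} (hl : σ.onLines l = l) : p ∉ l :=
  fun hpl => σ.no_fixed_point_on_fixed_line_q13 h12 hne hq hl hpl hp

omit [DecidableEq L] in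
/-- **q = 11: homology or 'two fixed points on every fixed line'.** Either some line is an axis — and then every
centre lies off it (a homology: Case A of FAMILY-B1P Lemma 4; a centre exists by `exists_center_of_axis`) — or
every fixed line carries exactly two fixed points (the starting point of Case B). -/
theorem order12_q11_axis_or_two (hq : σ.onPoints ^ 11 = 1) :
    (∃ (l : L) (c : P), σ.IsAxis l ∧ σ.IsCenter c ∧ c ∉ l) ∨
    ∀ l : L, σ.onLines l = l → ∀ [DecidablePred (· ∈ l)], σ.fixedOnLine l = 2 := by
  classical
  haveI : Fact (Nat.Prime 11) := ⟨by norm_num⟩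
  by_cases hax : ∃ l : L, σ.IsAxis l
  · obtain ⟨l, hl⟩ := hax
    obtain ⟨c, hc⟩ := σ.exists_center_of_axis hl
    exact Or.inl ⟨l, c, hl, hc, σ.center_not_mem_axis_order12_q11 h12 hne hq hl hc⟩
  · push Not at hax
    refine Or.inr fun l hl inst => ?_
    rcases σ.fixedOnLine_order12_q11 h12 hl hq with h2 | h13
    · convert h2
    · exfalso
      apply hax l
      have h13' : σ.fixedOnLine l = ProjectivePlane.order P L + 1 := by rw [h12]; convert h13
      exact σ.isAxis_of_fixedOnLine_eq h13'

end OrderTwelve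

end Collineation

end Summit.Ventures.DiscreteObjects.PP12
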